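import Mathlib

/-!
# Reciprocal certificates are not integral: the family `𝒮₄ = {{0},{1},{2},{3},{0,1,2,3}}`

Helper file for crux `stmt-CriticalPhenomena-4575` (`NoHeavyLowerTail`, route `PercNearOneGluingNoHeavy`),
new-inequality factory seat `prim-ineq-gen-3` (gen 23).  Everything here is PROVED; no definitions.

Notation (memo `run/shared/lean/prim/prim-ineq-gen-3/CONJECTURE-P2.md` §17): a reciprocal certificate for a member `A` of `𝒜` is a pair
`p q : D → K` (`D = 𝒜 \\ 𝒜`) with `Z p = δ_A = Y q` and `Y p = Z q`, where `(Z p)(C) = ∑_E p_E [E ⊆ C]`, `(Y p)(C) = ∑_E p_E [E ∩ C = ∅]`.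
Certificates for all members give 2-chain periodicity P2 over the field `K` (`twoChain_of_certificates`); every explicit certificate
constructed so far (Möbius, trace, interval, proxy, graph certificates) has INTEGER coefficients and therefore works in every characteristic
at once.  This file shows that integrality is NOT always possible:

* `not_exists_int_certificate_S4_top`, `not_exists_int_certificate_S4_leaf` — for `𝒮₄ = {{0},{1},{2},{3},{0,1,2,3}}` (four singletons
  and their union; `D = {∅, {i}, S ∖ {i}}`) neither the top nor a singleton has a reciprocal certificate with coefficients in `ℤ`.
  [The fifteen linear equations force `3 · p(∅) = -1` for the top; `decide` computes `D`, `omega` finds the contradiction.]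
Over every FIELD certificates do exist (coefficient `-1/3` at `∅` when `3 ≠ 0`; a different certificate in characteristic `3`, where the
unique relation becomes `μ = -λ`), and an integral certificate of exponent 2 exists (`linearIndependent_pencil_of_blocks_top`); so P2 is a
statement about fields, not about `ℤ` — it fails over the ring `ℤ/9` — and no characteristic-free degree-1 certificate construction can prove it
in general (memo FINDINGS-gen23.md F23-1; in general `𝒮_r` has denominator `r - 1`).
(prim-ineq-gen-3 gen 23, 2026-08-24.)
-/

namespace Summit.CriticalPhenomena.PercolationContinuityZ3.Theorems

namespace OrderedDifferences

open Finset
open scoped FinsetFamily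

/-- The difference family of `𝒮₄`. -/
private theorem S4_diffs :
    ({{0}, {1}, {2}, {3}, {0, 1, 2, 3}} : Finset (Finset (Fin 4))) \\ {{0}, {1}, {2}, {3}, {0, 1, 2, 3}} =
      {∅, {0}, {1}, {2}, {3}, {1, 2, 3}, {0, 2, 3}, {0, 1, 3}, {0, 1, 2}} := by
  decide

/-- **No integral reciprocal certificate for the top of `𝒮₄`.**  For `𝒜 = {{0},{1},{2},{3},S}`, `S = {0,1,2,3}`, there are no
`p q : Finset (Fin 4) → ℤ` with `Z p = δ_S = Y q` and `Y p = Z q` on `𝒜` (sums over `𝒜 \\ 𝒜`). -/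
theorem not_exists_int_certificate_S4_top :
    ¬ ∃ p q : Finset (Fin 4) → ℤ,
      (∀ C ∈ ({{0}, {1}, {2}, {3}, {0, 1, 2, 3}} : Finset (Finset (Fin 4))),
        ∑ W ∈ ({{0}, {1}, {2}, {3}, {0, 1, 2, 3}} : Finset (Finset (Fin 4))) \\ {{0}, {1}, {2}, {3}, {0, 1, 2, 3}},
          p W * (if W ⊆ C then (1 : ℤ) else 0) = if C = {0, 1, 2, 3} then 1 else 0) ∧
      (∀ C ∈ ({{0}, {1}, {2}, {3}, {0, 1, 2, 3}} : Finset (Finset (Fin 4))),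
        ∑ W ∈ ({{0}, {1}, {2}, {3}, {0, 1, 2, 3}} : Finset (Finset (Fin 4))) \\ {{0}, {1}, {2}, {3}, {0, 1, 2, 3}},
          q W * (if Disjoint W C then (1 : ℤ) else 0) = if C = {0, 1, 2, 3} then 1 else 0) ∧
      (∀ C ∈ ({{0}, {1}, {2}, {3}, {0, 1, 2, 3}} : Finset (Finset (Fin 4))),
        ∑ W ∈ ({{0}, {1}, {2}, {3}, {0, 1, 2, 3}} : Finset (Finset (Fin 4))) \\ {{0}, {1}, {2}, {3}, {0, 1, 2, 3}},
          p W * (if Disjoint W C then (1 : ℤ) else 0) =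
        ∑ W ∈ ({{0}, {1}, {2}, {3}, {0, 1, 2, 3}} : Finset (Finset (Fin 4))) \\ {{0}, {1}, {2}, {3}, {0, 1, 2, 3}},
          q W * (if W ⊆ C then (1 : ℤ) else 0)) := by
  rintro ⟨p, q, hp, hq, hpq⟩
  simp only [S4_diffs] at hp hq hpq
  have hp0 := hp {0} (by decide)
  have hp1 := hp {1} (by decide)
  have hp2 := hp {2} (by decide)
  have hp3 := hp {3} (by decide)
  have hpS := hp {0, 1, 2, 3} (by decide)
  have hq0 := hq {0} (by decide)
  have hq1 := hq {1} (by decide)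
  have hq2 := hq {2} (by decide)
  have hq3 := hq {3} (by decide)
  have hqS := hq {0, 1, 2, 3} (by decide)
  have hr0 := hpq {0} (by decide)
  have hr1 := hpq {1} (by decide)
  have hr2 := hpq {2} (by decide)
  have hr3 := hpq {3} (by decide)
  have hrS := hpq {0, 1, 2, 3} (by decide)
  simp (config := { decide := true }) [Finset.sum_insert, Finset.sum_singleton] at hp0 hp1 hp2 hp3 hpS hq0 hq1 hq2 hq3 hqS hr0 hr1 hr2 hr3 hrS
  omega

/-- **No integral reciprocal certificate for a singleton of `𝒮₄` either.**  The member `{0}` of `{{0},{1},{2},{3},{0,1,2,3}}` has no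
reciprocal certificate with integer coefficients (by symmetry, no singleton has one). -/
theorem not_exists_int_certificate_S4_leaf :
    ¬ ∃ p q : Finset (Fin 4) → ℤ,
      (∀ C ∈ ({{0}, {1}, {2}, {3}, {0, 1, 2, 3}} : Finset (Finset (Fin 4))),
        ∑ W ∈ ({{0}, {1}, {2}, {3}, {0, 1, 2, 3}} : Finset (Finset (Fin 4))) \\ {{0}, {1}, {2}, {3}, {0, 1, 2, 3}},
          p W * (if W ⊆ C then (1 : ℤ) else 0) = if C = {0} then 1 else 0) ∧
      (∀ C ∈ ({{0}, {1}, {2}, {3}, {0, 1, 2, 3}} : Finset (Finset (Fin 4))),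
        ∑ W ∈ ({{0}, {1}, {2}, {3}, {0, 1, 2, 3}} : Finset (Finset (Fin 4))) \\ {{0}, {1}, {2}, {3}, {0, 1, 2, 3}},
          q W * (if Disjoint W C then (1 : ℤ) else 0) = if C = {0} then 1 else 0) ∧
      (∀ C ∈ ({{0}, {1}, {2}, {3}, {0, 1, 2, 3}} : Finset (Finset (Fin 4))),
        ∑ W ∈ ({{0}, {1}, {2}, {3}, {0, 1, 2, 3}} : Finset (Finset (Fin 4))) \\ {{0}, {1}, {2}, {3}, {0, 1, 2, 3}},
          p W * (if Disjoint W C then (1 : ℤ) else 0) =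
        ∑ W ∈ ({{0}, {1}, {2}, {3}, {0, 1, 2, 3}} : Finset (Finset (Fin 4))) \\ {{0}, {1}, {2}, {3}, {0, 1, 2, 3}},
          q W * (if W ⊆ C then (1 : ℤ) else 0)) := by
  rintro ⟨p, q, hp, hq, hpq⟩
  simp only [S4_diffs] at hp hq hpq
  have hp0 := hp {0} (by decide)
  have hp1 := hp {1} (by decide)
  have hp2 := hp {2} (by decide)
  have hp3 := hp {3} (by decide)
  have hpS := hp {0, 1, 2, 3} (by decide)
  have hq0 := hq {0} (by decide)
  have hq1 := hq {1} (by decide)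
  have hq2 := hq {2} (by decide)
  have hq3 := hq {3} (by decide)
  have hqS := hq {0, 1, 2, 3} (by decide)
  have hr0 := hpq {0} (by decide)
  have hr1 := hpq {1} (by decide)
  have hr2 := hpq {2} (by decide)
  have hr3 := hpq {3} (by decide)
  have hrS := hpq {0, 1, 2, 3} (by decide)
  simp (config := { decide := true }) [Finset.sum_insert, Finset.sum_singleton] at hp0 hp1 hp2 hp3 hpS hq0 hq1 hq2 hq3 hqS hr0 hr1 hr2 hr3 hrS
  omega

end OrderedDifferences

end Summit.CriticalPhenomena.PercolationContinuityZ3.Theorems
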